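import Summits.BirchSwinnertonDyer.BirchSwinnertonDyer.Theorems.RamifiedSevenEllipticUnitsStrictTorsionOfGZKAnyPrime
import Summits.BirchSwinnertonDyer.BirchSwinnertonDyer.Theorems.RamifiedSevenEllipticUnitsStrictControlLocalAway
import Summits.BirchSwinnertonDyer.Rank1Residual.X11b.AnticyclotomicInertPlaces
import Summits.BirchSwinnertonDyer.Rank1Residual.X11b.AnticyclotomicRamifiedPlaces
import HarnessLib

set_option linter.dupNamespace false
set_option autoImplicit false

/-!
# Route `RamifiedSevenEllipticUnits` (rung K7r), crux `StrictTorsionSeven` (stmt-BirchSwinnertonDyer-19144):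
# in the ANTICYCLOTOMIC tower of a CM field the away-from-`p` local input is EMPTY —
# exact control and (R-tors)@`p` for every CM pair from GZK and the single input `E(K_𝔭)[p] = 0`

Cell `bsd-cm`, seat `bsd-cm-k7r-c3` (g4). HONEST FRAMING: nothing here closes crux #3; BSD is not
proved by any of this. Frame-level content of the typed objects (R-tors)/(R-ctrl) at EVERY
CM-ramified prime.

## The point

The K7r exact-control theorem (k7r-c4 g0, `controlMap_bijective_of_noPTorsion`) is stated for an
ARBITRARY `ℤ_p`-extension `κ` of a totally complex `K` and therefore asks, at every finite `v ∤ p`,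
for "good reduction or `E(K_v)[p] = 0`" — hypothesis (Av), discharged for 𝒞₇ at `7` through the
class clause «every bad `q ≠ 7` is CM-split» (`good_or_noSevenTorsion_of_classCSeven`). The typed
cruxes (R-tors) `X12.O11.RamifiedCMStrictTorsionAt` and (R-ctrl) `X12.O11.RamifiedCMStrictControlAt`
only ever quantify over ANTICYCLOTOMIC `κ` of the CM field `K` (imaginary QUADRATIC). There the sibling
cell has put the dihedral splitting law in the kernel: a finite place `v ∤ p` of `K` of residue
degree `2` (over an inert prime) or of ramification index `2` (over a ramified prime `≠ p`) splits
completely in `K_∞^{ac}` and Castella's away condition at `v` descends with NO hypothesis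
(`IsAnticyclotomic.resOfLe_mem_awayKer_iff_of_inertiaDeg_eq_two`,
`IsAnticyclotomic.resOfLe_mem_awayKer_iff_of_ramificationIdx_eq_two`). The remaining places have
degree one (`placesOver_trichotomy_of_finrank_eq_two`), where `K_v ≅ ℚ_ℓ` and, for a curve WITHOUT
multiplicative primes (every CM curve, `not_mult_of_hasCM`), a bad `ℓ ≠ p` is additive, so
`E(K_v)[p] = 0` for `p ≥ 5` (`noPTorsion_adicCompletion_of_degreeOne`, Mazur's Step 1); good places
descend for every `κ` (`resOfLe_mem_awayKer_kerSubgroup_iff_of_hasGoodReductionAt`). Hence: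

* `awayConditions_descend_of_isAnticyclotomic` — for `W/ℚ` elliptic with no multiplicative prime,
  `p ≥ 5`, `K` quadratic, `κ` anticyclotomic: the away conditions descend at EVERY finite `v ∤ p`
  (the hypothesis `hS` of `controlMap_bijective_of_away_descent`), no class clause, no local datum;
* `controlMap_bijective_of_noPTorsionAt_of_isAnticyclotomic` — so, for `K` imaginary quadratic,
  EXACT CONTROL `Sel_𝔭(K, E[p^∞]) ≅ Sel_𝔭(K_∞^{ac}, E[p^∞])^Γ` needs ONLY (A𝔭) `E(K_𝔭)[p] = 0`;
  `natCard_endInvariants_eq_natCard_selmerAcBase_of_noPTorsionAt_of_isAnticyclotomic`,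
  `finite_endInvariants_iff_finite_selmerAcBase_of_noPTorsionAt_of_isAnticyclotomic`;
* `strictControl_frame_natCard_eq_of_isAnticyclotomic` — the same at an O11 frame `(K, 𝔭, W', C)`
  of `(W, p)` (CM, `p ≥ 5`, `K` the CM field): k7r-c4's `strictControl_frame_natCard_eq` with (Av) GONE;
* **`ramifiedCMStrictTorsionAt_of_GZK_of_noPTorsionAt`** — (R-tors)@`p` at `W` for EVERY globally
  minimal `W` and EVERY prime `p` from the named fact GZK and the SINGLE local input (A𝔭) at every
  frame (this seat's `ramifiedCMStrictTorsionAt_of_GZK_of_noPTorsion` with `hv` discharged);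
* `strictTorsionSeven_of_GZK_of_noSevenTorsionAt` — the route item under GZK from (A𝔭) at `7` alone;
  fed with the seat's g0 division-polynomial theorem it re-derives `strictTorsionSeven_of_GZK`
  WITHOUT the 𝒞₇ clause on the bad primes (an `example`).

CONDITIONAL where GZK (`rank_eq_analyticRank_of_analyticRank_le_one`) is a hypothesis; everything
else is unconditional. No Euler system, no `Λ`-module structure theory is used.

References: [GreenbergLNM1716] §3 Lemmas 3.1–3.3, p. 87 (primes splitting completely), p. 90
(Thm. 1.2); [Washington1997] Prop. 13.2 and §13.1; Brink, Math. Comp. 76 (2007) §1 (inert primes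
split completely in the anticyclotomic extension); [Mazur1977] Ch. III §5 Step 1 (p. 158);
[Castella2018] Def. 2.2, Thm. 2.3 (arXiv:1704.06608 p. 5; shape only); [Kolyvagin1990] Thm. A (the
named fact); [BurungaleKobayashiNakamuraOta2026] (3.16) (arXiv:2608.06879; the remaining input (A𝔭),
shape only).
-/

noncomputable section

open scoped Classical

open WeierstrassCurve NumberField IsDedekindDomain Field
  Literature.NumberTheory.EllipticCurves
  Literature.NumberTheory.EllipticCurves.GreenbergSelmer
  Literature.NumberTheory.EllipticCurves.Rank1Residual
  Literature.NumberTheory.GaloisRepresentations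
  Summit.BirchSwinnertonDyer.Rank1Residual
  Summit.BirchSwinnertonDyer.Rank1Residual.X11b
  Summit.BirchSwinnertonDyer.Rank1Residual.X11b.AcSelmer

namespace Summit.BirchSwinnertonDyer.BirchSwinnertonDyer.Theorems.RamifiedSevenEllipticUnits

/-! ## §1 The away conditions descend in the anticyclotomic tower of a quadratic field -/

section Away

variable (W : WeierstrassCurve ℚ) [W.IsElliptic] {p : ℕ} [Fact p.Prime]
  {K : Type} [Field K] [NumberField K]

/-- **The away conditions descend at EVERY finite `v ∤ p`, anticyclotomic tower of a quadratic
field, no multiplicative prime.** Let `W/ℚ` be an elliptic curve with no prime of multiplicative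
reduction (e.g. a CM curve), `p ≥ 5`, `K` a number field with `[K : ℚ] = 2`, `κ` an ANTICYCLOTOMIC
`ℤ_p`-extension of `K`, `𝔭` any finite place, `Σ = ∅`. If `c ∈ H¹(K, W[p^∞])` restricts into
`Sel_𝔭(K_∞, W[p^∞])`, then `c` is locally trivial at every finite `v ∤ p`. At `v` over a good prime:
Greenberg's Lemma 3.3 (any `κ`); over a bad prime `ℓ`: `ℓ` is additive, and by the trichotomy for the
places of a quadratic field either `v` has degree one (`K_v ≅ ℚ_ℓ`, `W(ℚ_ℓ)[p] = 0` by Mazur's Step 1,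
so `ker r_v = 0`), or residue degree `2` or ramification index `2` — then `v` splits completely in the
anticyclotomic tower and the condition descends tautologically.
[cite: GreenbergLNM1716, §3 Lemma 3.3 and p. 87 (primes splitting completely)] [cite: Mazur1977, Ch. III §5 Step 1 (p. 158)] [cite: Washington1997, Prop. 13.2 and §13.1] -/
theorem awayConditions_descend_of_isAnticyclotomic (h5 : 5 ≤ p)
    (hnm : ∀ (ℓ : ℕ) [Fact ℓ.Prime], ¬ Mult W ℓ) (hK : Module.finrank ℚ K = 2)
    {κ : ZpExtension K p} (hκ : κ.IsAnticyclotomic) (𝔭 : HeightOneSpectrum (𝓞 K))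
    (c : (W.baseChange K).subgroupH1 p (⊤ : Subgroup (absoluteGaloisGroup K)))
    (hc : (W.baseChange K).resOfLe p (le_top : κ.kerSubgroup ≤ ⊤) c ∈
      selmerAc (W.baseChange K) p κ 𝔭 ∅)
    (v : HeightOneSpectrum (𝓞 K)) (hpv : ((p : ℕ) : 𝓞 K) ∉ v.asIdeal) :
    c ∈ awayKer ⊤ ((W.baseChange K).geomPrimaryTorsion p) v := by
  haveI : (W.baseChange K).IsElliptic := by rw [baseChange]; infer_instance
  have hvS : v ∉ (∅ : Set (HeightOneSpectrum (𝓞 K))) := Set.notMem_empty v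
  -- the away condition at the place of `K_∞` above `v`
  have h1 := ((mem_selmerOver_iff _).mp hc).1 v hpv hvS 1
  rw [Literature.NumberTheory.EllipticCurves.conjH1_one_holds, AddMonoidHom.id_apply] at h1
  -- the rational prime `ℓ` under `v`
  set v₀ : HeightOneSpectrum (𝓞 ℚ) := v.under (𝓞 ℚ) with hv₀def
  set ℓ : ℕ := (Rat.HeightOneSpectrum.primesEquiv v₀ : ℕ) with hℓdef
  haveI hℓ : Fact ℓ.Prime := ⟨(Rat.HeightOneSpectrum.primesEquiv v₀).2⟩
  have hv₀ : v.under (𝓞 ℚ) = ratPlace ℓ := by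
    rw [ratPlace, ← hv₀def]
    exact ((Rat.HeightOneSpectrum.primesEquiv (R := 𝓞 ℚ)).symm_apply_apply v₀).symm
  have hℓv : ((ℓ : ℕ) : 𝓞 K) ∈ v.asIdeal := mem_of_under_eq_ratPlace hv₀
  haveI : v.asIdeal.LiesOver v₀.asIdeal := ⟨rfl⟩
  have hℓp : ℓ ≠ p := by
    rintro h
    rw [h] at hℓv
    exact hpv hℓv
  by_cases hgood : Good W ℓ
  · -- good reduction base-changes to `K` at `v`, and the away condition descends for any `κ`
    have hgood' : W.HasGoodReductionAt v₀ :=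
      (hasGoodReductionAtPrime_primesEquiv_iff_holds W v₀ ℓ rfl).mp hgood
    have hgv : (W.baseChange K).HasGoodReductionAt v :=
      hasGoodReductionAt_baseChange_of_hasGoodReductionAt_rat W v₀ v hgood'
    exact (resOfLe_mem_awayKer_kerSubgroup_iff_of_hasGoodReductionAt (W.baseChange K) p κ hpv
      hgv c).mp h1
  · -- a bad prime `ℓ ≠ p`: additive (no multiplicative prime); trichotomy for the place `v`
    rcases placesOver_trichotomy_of_finrank_eq_two K hK v₀ with
      ⟨w₁, w₂, -, -, hef⟩ | ⟨w, hset, -, hf⟩ | ⟨w, hset, he, -⟩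
    · -- degree one: `K_v ≅ ℚ_ℓ`, `W(K_v)[p] = 0`, `ker r_v = 0`
      obtain ⟨he, hf⟩ := hef v rfl
      exact mem_awayKer_of_localKer_eq_bot hpv hvS
        (AcSelmer.localKer_eq_bot_of_noPTorsion (W.baseChange K) p κ v
          (noPTorsion_adicCompletion_of_degreeOne W ℓ Fact.out h5 hℓp hgood (hnm ℓ) v hℓv he hf))
        hc
    · -- residue degree two: `v` splits completely in the anticyclotomic tower
      have hvw : v = w := by
        have hmem : v ∈ {w' : HeightOneSpectrum (𝓞 K) | w'.under (𝓞 ℚ) = v₀} := rfl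
        rw [hset] at hmem
        exact hmem
      have hf' : v.asIdeal.inertiaDeg (𝓞 ℚ) = 2 := by rw [hvw]; exact hf
      exact (IsAnticyclotomic.resOfLe_mem_awayKer_iff_of_inertiaDeg_eq_two hK hκ hpv
        (ℓ := v₀) rfl hf' c).mp h1
    · -- ramification index two (`ℓ ≠ p` ramified in `K`): `v` splits completely as well
      have hvw : v = w := by
        have hmem : v ∈ {w' : HeightOneSpectrum (𝓞 K) | w'.under (𝓞 ℚ) = v₀} := rfl
        rw [hset] at hmem
        exact hmem
      have he' : v.asIdeal.ramificationIdx (𝓞 ℚ) = 2 := by rw [hvw]; exact he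
      exact (IsAnticyclotomic.resOfLe_mem_awayKer_iff_of_ramificationIdx_eq_two hK hκ hpv he' c).mp
        h1

end Away

/-! ## §2 Exact control from the single input `E(K_𝔭)[p] = 0` -/

section Control

variable (W : WeierstrassCurve ℚ) [W.IsElliptic] (p : ℕ) [Fact p.Prime]
  {K : Type} [Field K] [NumberField K]

/-- **EXACT CONTROL in the anticyclotomic tower of an imaginary quadratic field from ONE local
input.** `W/ℚ` elliptic without multiplicative primes, `p ≥ 5`, `K` imaginary quadratic, `κ`
anticyclotomic with topological generator `γ`, `𝔭` any finite place with (A𝔭) `W(K_𝔭)[p] = 0`: the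
control map `s : Sel_𝔭(K, W[p^∞]) → Sel_𝔭(K_∞, W[p^∞])^γ` (`Σ = ∅`) is bijective. Injectivity and the
strict place from (A𝔭) exactly as in k7r-c4's `controlMap_bijective_of_noPTorsion`; the away places
by `awayConditions_descend_of_isAnticyclotomic`; the infinite places are complex.
[cite: GreenbergLNM1716, §3 Lemmas 3.1–3.3 and p. 90 (Thm. 1.2)] [cite: Castella2018, Def. 2.2 and Thm. 2.3 (arXiv:1704.06608 p. 5) (shape only)] -/
theorem controlMap_bijective_of_noPTorsionAt_of_isAnticyclotomic (h5 : 5 ≤ p)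
    (hnm : ∀ (ℓ : ℕ) [Fact ℓ.Prime], ¬ Mult W ℓ) (hK : IsImaginaryQuadratic K)
    (κ : ZpExtension K p) (hκ : κ.IsAnticyclotomic) (𝔭 : HeightOneSpectrum (𝓞 K))
    (γ : absoluteGaloisGroup K) [hγ : Fact (κ.IsTopGenerator γ)]
    (h𝔭 : ∀ R : ((W.baseChange K).baseChange (𝔭.adicCompletion K)).toAffine.Point,
      p • R = 0 → R = 0) :
    Function.Bijective (controlMap (W.baseChange K) p κ 𝔭 ∅ γ) := by
  haveI : IsTotallyComplex K := hK.2
  haveI : (W.baseChange K).IsElliptic := by rw [baseChange]; infer_instance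
  exact controlMap_bijective_of_away_descent (W.baseChange K) p κ 𝔭 ∅ hγ.out
    (resSubgroup_kerSubgroup_injective_of_fixedPoints_eq_bot (W.baseChange K) p κ hγ.out
      (fixedPoints_kerSubgroup_eq_bot_of_noPTorsion (W.baseChange K) p κ 𝔭 h𝔭))
    (fixedPoints_decomp_inf_kerSubgroup_eq_bot_of_noPTorsion (W.baseChange K) p κ 𝔭 h𝔭)
    (fun c hc v hpv _ ↦ awayConditions_descend_of_isAnticyclotomic W h5 hnm hK.1 hκ 𝔭 c hc v hpv)

/-- **`#H⁰(Γ, Sel_𝔭(K_∞^{ac}, W[p^∞])) = #Sel_𝔭(K, W[p^∞])`** from (A𝔭) alone (same setting;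
`Nat.card`). [cite: GreenbergLNM1716, §3 Thm. 1.2 and p. 90] -/
theorem natCard_endInvariants_eq_natCard_selmerAcBase_of_noPTorsionAt_of_isAnticyclotomic
    (h5 : 5 ≤ p) (hnm : ∀ (ℓ : ℕ) [Fact ℓ.Prime], ¬ Mult W ℓ) (hK : IsImaginaryQuadratic K)
    (κ : ZpExtension K p) (hκ : κ.IsAnticyclotomic) (𝔭 : HeightOneSpectrum (𝓞 K))
    (γ : absoluteGaloisGroup K) [Fact (κ.IsTopGenerator γ)]
    (h𝔭 : ∀ R : ((W.baseChange K).baseChange (𝔭.adicCompletion K)).toAffine.Point,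
      p • R = 0 → R = 0) :
    Nat.card (IwasawaDual.endInvariants (conjSelmerAc (W.baseChange K) p κ 𝔭 ∅ γ - 1)) =
      Nat.card (selmerAcBase (W.baseChange K) p 𝔭 ∅) := by
  haveI : (W.baseChange K).IsElliptic := by rw [baseChange]; infer_instance
  exact (natCard_selmerAcBase_eq_of_bijective (W.baseChange K) p κ 𝔭 ∅ γ
    (controlMap_bijective_of_noPTorsionAt_of_isAnticyclotomic W p h5 hnm hK κ hκ 𝔭 γ h𝔭)).symm

/-- … and `H⁰(Γ, Sel_𝔭(K_∞^{ac}, W[p^∞]))` is finite iff `Sel_𝔭(K, W[p^∞])` is, from (A𝔭) alone.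
[cite: GreenbergLNM1716, §3 Thm. 1.2] -/
theorem finite_endInvariants_iff_finite_selmerAcBase_of_noPTorsionAt_of_isAnticyclotomic
    (h5 : 5 ≤ p) (hnm : ∀ (ℓ : ℕ) [Fact ℓ.Prime], ¬ Mult W ℓ) (hK : IsImaginaryQuadratic K)
    (κ : ZpExtension K p) (hκ : κ.IsAnticyclotomic) (𝔭 : HeightOneSpectrum (𝓞 K))
    (γ : absoluteGaloisGroup K) [Fact (κ.IsTopGenerator γ)]
    (h𝔭 : ∀ R : ((W.baseChange K).baseChange (𝔭.adicCompletion K)).toAffine.Point,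
      p • R = 0 → R = 0) :
    Finite (IwasawaDual.endInvariants (conjSelmerAc (W.baseChange K) p κ 𝔭 ∅ γ - 1)) ↔
      Finite (selmerAcBase (W.baseChange K) p 𝔭 ∅) := by
  haveI : (W.baseChange K).IsElliptic := by rw [baseChange]; infer_instance
  exact (finite_selmerAcBase_iff_of_bijective (W.baseChange K) p κ 𝔭 ∅ γ
    (controlMap_bijective_of_noPTorsionAt_of_isAnticyclotomic W p h5 hnm hK κ hκ 𝔭 γ h𝔭)).symm

end Control

/-! ## §3 At an O11 frame: exact control with the away input gone -/

section Frame

variable {W : WeierstrassCurve ℚ} [W.IsElliptic] {p : ℕ} [Fact p.Prime]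
  {K : Type} [Field K] [NumberField K] {𝔭 : HeightOneSpectrum (𝓞 K)}
  {W' : WeierstrassCurve ℚ} {C : VariableChange ℚ}

/-- **Exact control at an O11 frame, anticyclotomic `κ`, from (A𝔭) alone.** At a frame
`(K, 𝔭, W', C)` of `(W, p)` (`W` CM — hence no multiplicative prime —, `p ≥ 5`, `K` the CM field,
imaginary quadratic), for every ANTICYCLOTOMIC `ℤ_p`-extension `κ` and topological generator `γ`:
granted `W(K_𝔭)[p] = 0`, `#H⁰(Γ, Sel_𝔭(K_∞, W[p^∞])) = #Sel_𝔭(K, W[p^∞])`. This is k7r-c4's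
`strictControl_frame_natCard_eq` with its hypothesis `hv` discharged for every CM pair.
[cite: GreenbergLNM1716, §3 Thm. 1.2, Lemma 3.3 and p. 87] [cite: BurungaleKobayashiNakamuraOta2026, (3.16) (arXiv:2608.06879; the remaining input, shape only)] -/
theorem strictControl_frame_natCard_eq_of_isAnticyclotomic (hF : X12.O11.IsFrame W p K 𝔭 W' C)
    (κ : ZpExtension K p) (hκ : κ.IsAnticyclotomic) (γ : absoluteGaloisGroup K)
    [Fact (κ.IsTopGenerator γ)]
    (h𝔭 : ∀ R : ((W.baseChange K).baseChange (𝔭.adicCompletion K)).toAffine.Point,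
      p • R = 0 → R = 0) :
    Nat.card (IwasawaDual.endInvariants
        (Castella2018.AcSelmer.conjSelmerAc (W.baseChange K) p κ 𝔭 ∅ γ - 1)) =
      Nat.card (selmerAcBase (W.baseChange K) p 𝔭 ∅) :=
  natCard_endInvariants_eq_natCard_selmerAcBase_of_noPTorsionAt_of_isAnticyclotomic W p hF.2.2.1
    (fun ℓ _ ↦ not_mult_of_hasCM W hF.1 ℓ) hF.2.2.2.1 κ hκ 𝔭 γ h𝔭

/-- … and the finiteness form. [cite: GreenbergLNM1716, §3 Thm. 1.2] -/
theorem strictControl_frame_finite_iff_of_isAnticyclotomic (hF : X12.O11.IsFrame W p K 𝔭 W' C)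
    (κ : ZpExtension K p) (hκ : κ.IsAnticyclotomic) (γ : absoluteGaloisGroup K)
    [Fact (κ.IsTopGenerator γ)]
    (h𝔭 : ∀ R : ((W.baseChange K).baseChange (𝔭.adicCompletion K)).toAffine.Point,
      p • R = 0 → R = 0) :
    Finite (IwasawaDual.endInvariants
        (Castella2018.AcSelmer.conjSelmerAc (W.baseChange K) p κ 𝔭 ∅ γ - 1)) ↔
      Finite (selmerAcBase (W.baseChange K) p 𝔭 ∅) :=
  finite_endInvariants_iff_finite_selmerAcBase_of_noPTorsionAt_of_isAnticyclotomic W p hF.2.2.1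
    (fun ℓ _ ↦ not_mult_of_hasCM W hF.1 ℓ) hF.2.2.2.1 κ hκ 𝔭 γ h𝔭

end Frame

/-! ## §4 (R-tors) at every CM-ramified prime from GZK and `E(K_𝔭)[p] = 0` alone -/

/-- **(R-tors)@`p` at `W` ⟸ (A𝔭) ∧ (F), every prime, no away input.** If at every O11 frame of
`(W, p)` (A𝔭) `W(K_𝔭)[p] = 0` and (F) `Sel_𝔭(K, W[p^∞])` is finite in analytic rank one, then
`X12.O11.RamifiedCMStrictTorsionAt W p` (exact control for anticyclotomic `κ` + Greenberg's criterion
on the dual pair). The seat's g0 `ramifiedCMStrictTorsionAt_of_noPTorsion_of_finite_base` with `hv`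
discharged. [cite: GreenbergLNM1716, §1 p. 61, §3 Thm. 1.2 and §4 Lemma 4.2] -/
theorem ramifiedCMStrictTorsionAt_of_noPTorsionAt_of_finite_base
    (W : WeierstrassCurve ℚ) [W.IsElliptic] (p : ℕ) [Fact p.Prime]
    (h𝔭 : ∀ (K : Type) [Field K] [NumberField K] (𝔭 : HeightOneSpectrum (𝓞 K))
      (W' : WeierstrassCurve ℚ) [W'.IsElliptic] [W'.IsGloballyMinimal] (C : VariableChange ℚ),
      X12.O11.IsFrame W p K 𝔭 W' C →
      ∀ R : ((W.baseChange K).baseChange (𝔭.adicCompletion K)).toAffine.Point, p • R = 0 → R = 0)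
    (hfin : ∀ (K : Type) [Field K] [NumberField K] (𝔭 : HeightOneSpectrum (𝓞 K))
      (W' : WeierstrassCurve ℚ) [W'.IsElliptic] [W'.IsGloballyMinimal] (C : VariableChange ℚ),
      X12.O11.IsFrame W p K 𝔭 W' C → W.analyticRank = 1 →
      Finite (selmerAcBase (W.baseChange K) p 𝔭 ∅)) :
    X12.O11.RamifiedCMStrictTorsionAt W p :=
  ramifiedCMStrictTorsionAt_of_finite_invariants W p fun K _ _ 𝔭 W' _ _ C hF hr κ hκ γ _ ↦
    (strictControl_frame_finite_iff_of_isAnticyclotomic hF κ hκ γ (h𝔭 K 𝔭 W' C hF)).mpr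
      (hfin K 𝔭 W' C hF hr)

/-- **(R-tors)@`p` at `W` ⟸ GZK ∧ (A𝔭), for EVERY globally minimal `W/ℚ` and EVERY prime `p`.**
Granted the named fact GZK, if at every O11 frame `(K, 𝔭, W', C)` of `(W, p)` the single local
statement (A𝔭) `W(K_𝔭)[p] = 0` holds, then `X12.O11.RamifiedCMStrictTorsionAt W p`. ((F) is
`finite_selmerAcBase_frame_of_GZK_prime`.) For 𝒞₇ at `7`, (A𝔭) is the seat's g0 division-polynomial
theorem; at `p ∈ {11, 19, 43, 67, 163}` it is seat k7r-c4's programme (items (i)–(ii)); its items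
(iii)–(iv) (the away places) are no longer needed for (R-tors)/(R-ctrl). CONDITIONAL on GZK
(hypothesis `hGZK`). [cite: Kolyvagin1990, Thm. A] [cite: GreenbergLNM1716, §1 p. 61, §3 Thm. 1.2 and §4 Lemma 4.2] -/
theorem ramifiedCMStrictTorsionAt_of_GZK_of_noPTorsionAt
    (hGZK : rank_eq_analyticRank_of_analyticRank_le_one)
    (W : WeierstrassCurve ℚ) [W.IsElliptic] [W.IsGloballyMinimal] (p : ℕ) [Fact p.Prime]
    (h𝔭 : ∀ (K : Type) [Field K] [NumberField K] (𝔭 : HeightOneSpectrum (𝓞 K))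
      (W' : WeierstrassCurve ℚ) [W'.IsElliptic] [W'.IsGloballyMinimal] (C : VariableChange ℚ),
      X12.O11.IsFrame W p K 𝔭 W' C →
      ∀ R : ((W.baseChange K).baseChange (𝔭.adicCompletion K)).toAffine.Point, p • R = 0 → R = 0) :
    X12.O11.RamifiedCMStrictTorsionAt W p :=
  ramifiedCMStrictTorsionAt_of_noPTorsionAt_of_finite_base W p h𝔭
    fun _ _ _ _ _ _ _ _ hF h1 ↦ finite_selmerAcBase_frame_of_GZK_prime hGZK W p hF h1

/-- **`StrictTorsionSeven` ⟸ GZK ∧ (A𝔭)@7 on 𝒞₇** — the route item from the named fact and the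
single local statement `W(K_𝔭)[7] = 0` at every frame of every `W ∈ 𝒞₇`; the 𝒞₇ clause on the bad
primes `q ≠ 7` is NOT used. [cite: Kolyvagin1990, Thm. A] [cite: GreenbergLNM1716, §3 Thm. 1.2 and p. 87] -/
theorem strictTorsionSeven_of_GZK_of_noSevenTorsionAt
    (hGZK : rank_eq_analyticRank_of_analyticRank_le_one)
    (h𝔭 : ∀ (W : WeierstrassCurve ℚ) [W.IsElliptic] [W.IsGloballyMinimal] [Fact (Nat.Prime 7)],
      X12.ClassCSeven W →
      ∀ (K : Type) [Field K] [NumberField K] (𝔭 : HeightOneSpectrum (𝓞 K))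
        (W' : WeierstrassCurve ℚ) [W'.IsElliptic] [W'.IsGloballyMinimal] (C : VariableChange ℚ),
        X12.O11.IsFrame W 7 K 𝔭 W' C →
        ∀ R : ((W.baseChange K).baseChange (𝔭.adicCompletion K)).toAffine.Point, 7 • R = 0 → R = 0) :
    Summit.BirchSwinnertonDyer.BirchSwinnertonDyer.Theses.RamifiedSevenEllipticUnits.StrictTorsionSeven :=
  fun W _ _ _ hC ↦ ramifiedCMStrictTorsionAt_of_GZK_of_noPTorsionAt hGZK W 7 (h𝔭 W hC)

/- Consistency: with the seat's g0 local theorem at the ramified prime this is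
`strictTorsionSeven_of_GZK` again — now WITHOUT `good_or_noSevenTorsion_of_classCSeven`. -/
example (hGZK : rank_eq_analyticRank_of_analyticRank_le_one) :
    Summit.BirchSwinnertonDyer.BirchSwinnertonDyer.Theses.RamifiedSevenEllipticUnits.StrictTorsionSeven :=
  strictTorsionSeven_of_GZK_of_noSevenTorsionAt hGZK fun W _ _ _ hC _ _ _ 𝔭 W' _ _ C hF ↦
    SevenTorsion.seven_nsmul_adicCompletion_eq_zero_of_isFrame W hC 𝔭 W' C hF

end Summit.BirchSwinnertonDyer.BirchSwinnertonDyer.Theorems.RamifiedSevenEllipticUnits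

end
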